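import Summits.CriticalPhenomena.SAWScalingLimit.Theorems.SAWDevelopingMapHexConjectureKPDefs
import Summits.CriticalPhenomena.SAWScalingLimit.Theorems.SAWDevelopingMapHexConjectureWindowMassCube
import HarnessLib

/-!
# Crux `HexConjecture` (stmt-CriticalPhenomena-0808), line `root-locality-replaces-loewner`:
the geometric transfer of the Krachun–Panagiotis confined strip bound to the window two-point
lower bound

Landing target:
`Summits/CriticalPhenomena/SAWScalingLimit/Theorems/SAWDevelopingMapHexConjectureKPTransfer.lean`
(`--supports stmt-CriticalPhenomena-0808`; registered stub `stub_kp_transfer`).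

The line's lever is the WINDOW TWO-POINT LOWER BOUND: for some `0 < θ_a < θ_b ≤ 1/4`, `C > 0`,
`R₀ > 0` and all `R ≥ R₀`, for every cell `x`, the upper half-box
`B = {v : rows ≥ x₁, |c_v - mid s_x| ≤ R}` of the root mid-edge `s_x = {(x - e₁, 1), (x, 0)}` and
the lattice window `S' = [θ_a R, θ_b R] ∩ ℤ`,
`triDl ⌊R/4⌋ ≤ C · Σ_{d ∈ S'} Z_B(s_x → t_{x + d e₀})`.
The Krachun–Panagiotis renewal machinery produces the CONFINED bound
`c · triDl (9T) ≤ W T` (`T ≥ 1`), where `W T` is the `x_c`-mass of the coded mid-edge walks of the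
Duminil-Copin–Smirnov strip `S_{32T+1,32T+1}` from the root to the floor mid-edge at abscissa `d`,
summed over `d ∈ [T, 21T]`.  This file is the purely geometric transfer from the strip statement to
the window bound, exactly as `stub_triDl_cube_le_windowMass_of_coded` transfers `key_ineq`:
with `θ_a = 1/168`, `θ_b = 1/4`, `C = c⁻¹`, `R₀ = 600` and `T = ⌈R/168⌉`,

* `9T ≤ ⌊R/4⌋`, so `triDl ⌊R/4⌋ ≤ triDl (9T) ≤ c⁻¹ W T` (`triDl_antitone`);
* each coded sum at offset `d`, `|d| ≤ 32T + 1`, is the arch mass `Z_{S_x(32T)}(s_x → t_{x + d e₀})`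
  of the half-strip `S_x(32T) = Φ_x⁻¹ V(S_{32T+1,32T+1})` (`archMass_halfStrip_offset`);
* `S_x(32T) ⊆ B`, because its vertices lie in the rows `≥ x₁` within distance `128T + 4 ≤ R` of
  `mid s_x` (`halfStrip_geometry`), so `Z_{S_x(32T)} ≤ Z_B` (`archMass_mono`);
* `[T, 21T] ⊆ S'` (`R/168 ≤ T` and `21T < 21(R/168 + 1) ≤ R/4`) and arch masses are nonnegative.
-/

noncomputable section

open scoped BigOperators Topology Classical
open Literature.Probability.LatticeModels (HexVertex hexGraph hexCenter Site)
open Literature.Probability.RandomPlanarGeometry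
open Literature.Probability.RandomPlanarGeometry.SAW
open Literature.Probability.RandomPlanarGeometry.SAW.HV
open Summit.CriticalPhenomena.SAWScalingLimit.Theorems.ObservableToSLE.FloorRatio

namespace Summit.CriticalPhenomena.SAWScalingLimit.Theorems.HexConjecture.RootLocality

/-- **The half-strip `S_x(32T)` lies in the upper half-box of radius `R`** as soon as
`128 T + 4 ≤ R`: its vertices are in the rows `≥ x₁` within distance `4 · 32T + 4` of `mid s_x`
(`halfStrip_geometry`). [cite: DuminilCopinSmirnov2012, §3] -/
theorem kpTransfer_halfStrip_subset_halfBox (x : Site 2) (T : ℕ) {R : ℝ}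
    (hR : 128 * (T : ℝ) + 4 ≤ R) {B : Finset HexVertex}
    (hB : ∀ v : HexVertex, v ∈ B ↔ (x 1 ≤ v.1 1 ∧
      dist (hexCenter v) (hexMidpoint s((x - Pi.single 1 1, 1), (x, 0))) ≤ R)) :
    (stripV (32 * T + 1) (32 * T + 1)).map
        (hvIso.trans (shift (-(x 0)) (-(x 1)))).symm.toEquiv.toEmbedding ⊆ B := by
  intro w hw
  have hg := halfStrip_geometry (x := x) (N := 32 * T) hw
  rw [hB]
  refine ⟨hg.1, hg.2.trans ?_⟩
  push_cast
  linarith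

/-- **The window `[T, 21T]`, `T = ⌈R/168⌉`, lies in the lattice window `[R/168, R/4]`** for
`R ≥ 168`: `R/168 ≤ T` and `21 T < 21 (R/168 + 1) = R/8 + 21 ≤ R/4`. [folklore] -/
theorem kpTransfer_Icc_subset_window {R : ℝ} (hR : 168 ≤ R) {S' : Finset ℤ}
    (hS' : ∀ d : ℤ, d ∈ S' ↔ ((1 / 168 : ℝ) * R ≤ (d : ℝ) ∧ (d : ℝ) ≤ (1 / 4 : ℝ) * R)) :
    Finset.Icc (⌈R / 168⌉₊ : ℤ) (21 * (⌈R / 168⌉₊ : ℤ)) ⊆ S' := by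
  intro d hd
  rw [Finset.mem_Icc] at hd
  rw [hS']
  have hT1 : R / 168 ≤ ((⌈R / 168⌉₊ : ℕ) : ℝ) := Nat.le_ceil _
  have hT2 : ((⌈R / 168⌉₊ : ℕ) : ℝ) < R / 168 + 1 := Nat.ceil_lt_add_one (by positivity)
  have h1 : ((⌈R / 168⌉₊ : ℤ) : ℝ) ≤ (d : ℝ) := by exact_mod_cast hd.1
  have h2 : (d : ℝ) ≤ ((21 * (⌈R / 168⌉₊ : ℤ) : ℤ) : ℝ) := by exact_mod_cast hd.2
  push_cast at h1 h2
  constructor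
  · linarith
  · linarith

/-- **Scale comparison**: `9 ⌈R/168⌉ ≤ ⌊R/4⌋` for `R ≥ 168`, since
`9 ⌈R/168⌉ < 9R/168 + 9 ≤ R/4`. [folklore] -/
theorem kpTransfer_nine_mul_ceil_le_floor {R : ℝ} (hR : 168 ≤ R) :
    9 * ⌈R / 168⌉₊ ≤ ⌊R / 4⌋₊ := by
  apply Nat.le_floor
  have hT2 : ((⌈R / 168⌉₊ : ℕ) : ℝ) < R / 168 + 1 := Nat.ceil_lt_add_one (by positivity)
  push_cast
  linarith

/-- **Registered sub-goal `stub_kp_transfer`** (crux item stmt-CriticalPhenomena-0808, line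
`root-locality-replaces-loewner`): the geometric transfer from the confined strip bound to the
WINDOW TWO-POINT LOWER BOUND.  If `W T` is the `x_c`-mass of the coded mid-edge walks of the strip
`S_{32T+1,32T+1}` from the root to the floor mid-edges at abscissae `d ∈ [T, 21T]`, and
`c · triDl (9T) ≤ W T` for all `T ≥ 1`, then with `θ_a = 1/168`, `θ_b = 1/4`, `C = c⁻¹`,
`R₀ = 600`: for every `R ≥ R₀`, every cell `x`, the upper half-box
`B = {v : rows ≥ x₁, |c_v - mid s_x| ≤ R}` and the lattice window `S' = [θ_a R, θ_b R] ∩ ℤ`,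
`triDl ⌊R/4⌋ ≤ C · Σ_{d ∈ S'} Z_B(s_x → t_{x + d e₀})` — by monotonicity of `triDl`
(`T = ⌈R/168⌉`, `9T ≤ ⌊R/4⌋`), translation invariance (`archMass_halfStrip_offset`), exact
restriction (`archMass_mono`, `S_x(32T) ⊆ B`) and the inclusion of the windows `[T, 21T] ⊆ S'`.
[cite: KrachunPanagiotis2026, §3 (Corollary 3.1: the window `G_k`, `k ∈ [T, 21T]`)] -/
theorem stub_kp_transfer : ∀ (W : ℕ → ℝ), (∀ T : ℕ, W T = ∑ d ∈ Finset.Icc (T : ℤ) (21 * T), ∑ P ∈ (Literature.Probability.RandomPlanarGeometry.SAW.HV.midWalks (Literature.Probability.RandomPlanarGeometry.SAW.HV.stripV (32 * T + 1) (32 * T + 1))).filter (fun P => Literature.Probability.RandomPlanarGeometry.SAW.HV.finalDart P = ((d, 0, false), (d, -1, true)) ∨ Literature.Probability.RandomPlanarGeometry.SAW.HV.finalDart P = ((d, -1, true), (d, 0, false))), Literature.Probability.RandomPlanarGeometry.SAW.hexCriticalFugacity ^ Literature.Probability.RandomPlanarGeometry.SAW.HV.mwLen P) → (∃ c : ℝ,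 0 < c ∧ ∀ T : ℕ, 1 ≤ T → c * Literature.Probability.RandomPlanarGeometry.SAW.HV.triDl (9 * T) ≤ W T) → ∃ θa θb C : ℝ, 0 < θa ∧ θa < θb ∧ θb ≤ 1 / 4 ∧ 0 < C ∧ ∃ R₀ : ℝ, 0 < R₀ ∧ ∀ R : ℝ, R₀ ≤ R → ∀ (x : Literature.Probability.LatticeModels.Site 2) (B : Finset Literature.Probability.LatticeModels.HexVertex) (S' : Finset ℤ), (∀ v : Literature.Probability.LatticeModels.HexVertex, v ∈ B ↔ (x 1 ≤ v.1 1 ∧ dist (Literature.Probability.LatticeModels.hexCenter v) (Literature.Probability.RandomPlanarGeometry.SAW.hexMidpoint s((x - Pi.single 1 1, 1), (x, 0))) ≤ R)) → (∀ d : ℤ, d ∈ S' ↔ (θa * R ≤ (d : ℝ) ∧ (d : ℝ) ≤ θb * R)) → Literature.Probability.RandomPlanarGeometry.SAW.HV.triDl ⌊R / 4⌋₊ ≤ C * ∑ d ∈ S', ∑ γ : Literature.Probability.RandomPlanarGeometry.SAW.HexMidEdgeSAW B s((x - Pi.single 1 1, 1), (x, 0)) s((x + Pi.single 0 d - Pi.single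 1 1, 1), (x + Pi.single 0 d, 0)), Literature.Probability.RandomPlanarGeometry.SAW.hexCriticalFugacity ^ γ.length := by
  rintro W hW ⟨c, hc, hcW⟩
  refine ⟨1 / 168, 1 / 4, c⁻¹, by norm_num, by norm_num, le_rfl, inv_pos.2 hc, 600, by norm_num,
    ?_⟩
  intro R hR x B S' hB hS'
  have hwin := kpTransfer_Icc_subset_window (R := R) (by linarith) hS'
  have h9 := kpTransfer_nine_mul_ceil_le_floor (R := R) (by linarith)
  have hT1 : 1 ≤ ⌈R / 168⌉₊ := Nat.one_le_ceil_iff.2 (by positivity)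
  have hTlt : ((⌈R / 168⌉₊ : ℕ) : ℝ) < R / 168 + 1 := Nat.ceil_lt_add_one (by positivity)
  set T : ℕ := ⌈R / 168⌉₊
  -- the half-strip `S_x(32T)` and its inclusion in the half-box
  set HS := (stripV (32 * T + 1) (32 * T + 1)).map
    (hvIso.trans (shift (-(x 0)) (-(x 1)))).symm.toEquiv.toEmbedding
  have hsub : HS ⊆ B := kpTransfer_halfStrip_subset_halfBox x T (by linarith) hB
  set s : Sym2 HexVertex := s((x - Pi.single 1 1, 1), (x, 0))
  have hc' : (0 : ℝ) ≤ c⁻¹ := inv_nonneg.2 hc.le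
  calc triDl ⌊R / 4⌋₊ ≤ triDl (9 * T) := triDl_antitone h9
    _ = c⁻¹ * (c * triDl (9 * T)) := (inv_mul_cancel_left₀ hc.ne' _).symm
    _ ≤ c⁻¹ * W T := mul_le_mul_of_nonneg_left (hcW T hT1) hc'
    _ = c⁻¹ * ∑ d ∈ Finset.Icc (T : ℤ) (21 * T), ∑ γ : HexMidEdgeSAW HS s
            s((x + Pi.single 0 d - Pi.single 1 1, 1), (x + Pi.single 0 d, 0)),
            hexCriticalFugacity ^ γ.length := by
        rw [hW T]
        refine congrArg (fun t : ℝ => c⁻¹ * t) (Finset.sum_congr rfl fun d hd => ?_)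
        rw [Finset.mem_Icc] at hd
        have hd' : |d| ≤ ((32 * T : ℕ) : ℤ) + 1 := by
          rw [abs_le]; push_cast; constructor <;> omega
        exact (archMass_halfStrip_offset x (32 * T) d hd').symm
    _ ≤ c⁻¹ * ∑ d ∈ Finset.Icc (T : ℤ) (21 * T), ∑ γ : HexMidEdgeSAW B s
            s((x + Pi.single 0 d - Pi.single 1 1, 1), (x + Pi.single 0 d, 0)),
            hexCriticalFugacity ^ γ.length :=
        mul_le_mul_of_nonneg_left (Finset.sum_le_sum fun d _ => archMass_mono hsub s _) hc'
    _ ≤ c⁻¹ * ∑ d ∈ S', ∑ γ : HexMidEdgeSAW B s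
            s((x + Pi.single 0 d - Pi.single 1 1, 1), (x + Pi.single 0 d, 0)),
            hexCriticalFugacity ^ γ.length :=
        mul_le_mul_of_nonneg_left
          (Finset.sum_le_sum_of_subset_of_nonneg hwin fun d _ _ => archMass_nonneg _ _ _) hc'

end Summit.CriticalPhenomena.SAWScalingLimit.Theorems.HexConjecture.RootLocality

end
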